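import Literature.Geometry.Manifold.DeRhamProductDefectDegreeZero
import Literature.Geometry.Kaehler.StarShapedLocalPoincare
import HarnessLib

/-!
# Multiplicativity of the de Rham comparison for external products: coordinate open sets of the model space

Continuing `DeRhamProductDefect.lean` / `DeRhamProductDefectDegreeZero.lean`, take the first factor
to be a finite-dimensional real normed space `E` (a manifold modelled on itself).  For a linear
isomorphism `φ : E ≃L[ℝ] ℝᵈ` let `Q m = {x | ∃ j < m, φ x j ≠ 0}` (the complement of the coordinate
subspace `x₀ = ⋯ = x_{m-1} = 0`; `Q 0 = ∅`, and `Q (k+1) ≃ (ℝᵏ⁺¹ ∖ 0) × ℝ^{d-k-1}` detects `Hᵏ`).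
We prove that the two sides `lhs`, `rhs` AGREE on `(E, Q m)` in all degrees (`agree_coordOpen`):

* `Q (m+1) = A m ∪ B m` with `A m = Q m ∪ {φ x m > 0}` and `B m = Q m ∪ {φ x m < 0}` open and
  STAR-SHAPED (about `±φ⁻¹ eₘ`), and `A m ∩ B m = Q m`;
* on a union `A ∪ B` of star-shaped open sets the two sides agree as soon as they agree on `A ∩ B`
  (`agree_union_of_starConvex`): in form-degree `0` by `lhs_eq_rhs_of_degree_zero`; in degree
  `k + 1` the Mayer–Vietoris connecting map `δ : Hᵏ(Ω•(A ∩ B)) → Hᵏ⁺¹(Ω•(A ∪ B))` is ONTO, because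
  `Hᵏ⁺¹(Ω•(A)) = Hᵏ⁺¹(Ω•(B)) = 0` (Poincaré lemma for star-shaped sets,
  `localDeRhamComplex.isZero_homology_of_starConvex`), and both sides commute with the connecting
  maps (`lhs_δ`, `rhs_δ`).

This is the Mayer–Vietoris induction of Bredon's proof of the multiplicativity of the de Rham
isomorphism (Bredon (1993), Thm. V.9.5 with §VI.4), organised so that only SURJECTIVITY of `δ` is
used (agreement on the pieces of a cover does not propagate to the union in general).

Everything is proved; no named facts.

## References

* [Bredon1993] G. E. Bredon, *Topology and Geometry*, GTM 139 (1993), §V.9 Thm. V.9.5, Lemma V.9.4.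
* [BottTu1982Forms] R. Bott, L. W. Tu, *Differential Forms in Algebraic Topology* (1982), §I.2 Prop. 2.3, §I.5.
-/

noncomputable section

-- see "Implementation notes" in `…SingularHomology.SingularChainsConcrete`
set_option backward.isDefEq.respectTransparency false

open scoped Manifold ContDiff Topology
open CategoryTheory Limits Set Literature.AlgebraicTopology.SingularHomology Literature.Geometry.Kaehler

universe u

namespace Literature.Geometry.Manifold

variable {E : Type u} [NormedAddCommGroup E] [NormedSpace ℝ E] [FiniteDimensional ℝ E]
  {E' : Type u} [NormedAddCommGroup E'] [NormedSpace ℝ E'] {H' : Type u} [TopologicalSpace H']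
  {I' : ModelWithCorners ℝ E' H'} {N : Type u} [TopologicalSpace N] [ChartedSpace H' N] [IsManifold I' ∞ N]
  [I'.Boundaryless] [FiniteDimensional ℝ E'] [T2Space N] [SecondCountableTopology N] [LocallyCompactSpace N]
  {l : ℕ}

/-! ### Agreement of the two sides on an open set of the model space -/

variable (N) in
/-- **The two sides agree on `(E, W)`**: `lhs = rhs` on `Hᵏ(Ω•(W))` in all degrees. [folklore] -/
def Agree (β : closedSmoothForms I' N ℝ l) (W : Set E) (hW : IsOpen W) : Prop :=
  ∀ (k n : ℕ) (h : k + l = n) (a : (localDeRhamComplex 𝓘(ℝ, E) ℝ hW).homology k),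
    lhs N hW β k n h a = rhs N hW β k n h a

/-- Agreement only depends on the set. [folklore] -/
theorem agree_congr_set (β : closedSmoothForms I' N ℝ l) {S T : Set E} (e : S = T) (hS : IsOpen S) (hT : IsOpen T)
    (h : Agree N β S hS) : Agree N β T hT := by
  subst e
  exact h

/-- **Agreement on the empty set** (its de Rham complex is zero). [folklore] -/
theorem agree_empty (β : closedSmoothForms I' N ℝ l) : Agree N β (∅ : Set E) isOpen_empty := by
  intro k n h a
  obtain ⟨z, hz, rfl⟩ := homologyCls_surjective a
  have h0 : z = 0 := Subtype.ext (funext fun x ↦ z.2.2 x (notMem_empty x))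
  subst h0
  rw [homologyCls_zero, map_zero, map_zero]

/-- **The Mayer–Vietoris connecting map of de Rham complexes is onto in positive degrees when the
pieces are acyclic in the target degree.** [cite: BottTu1982Forms, Prop. 2.3] -/
theorem localDeRhamComplex.mvδ_surjective_of_isZero {A B : Set E} (hA : IsOpen A) (hB : IsOpen B) (k : ℕ)
    (hZA : IsZero ((localDeRhamComplex 𝓘(ℝ, E) ℝ hA).homology (k + 1)))
    (hZB : IsZero ((localDeRhamComplex 𝓘(ℝ, E) ℝ hB).homology (k + 1))) :
    Function.Surjective ((localDeRhamComplex.mvShortComplex_shortExact (I := 𝓘(ℝ, E)) (F := ℝ) (hA := hA)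
      (hB := hB)).δ k (k + 1) (crel k)) := by
  have hex := (localDeRhamComplex.mvShortComplex_shortExact (I := 𝓘(ℝ, E)) (F := ℝ) (hA := hA) (hB := hB)).homology_exact₁
    k (k + 1) (crel k)
  have hZ : IsZero (((localDeRhamComplex 𝓘(ℝ, E) ℝ hA) ⊞ (localDeRhamComplex 𝓘(ℝ, E) ℝ hB)).homology (k + 1)) :=
    isZero_homology_biprod _ _ (k + 1) hZA hZB
  have hepi := hex.epi_f (hZ.eq_of_tgt _ _)
  exact (ModuleCat.epi_iff_surjective _).1 hepi

/-- **Agreement on a union of star-shaped open sets from agreement on the intersection** (degree `0`: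
`lhs_eq_rhs_of_degree_zero`; positive degree: `δ` is onto and both sides commute with `δ`).
[cite: Bredon1993, Thm. V.9.5] -/
theorem agree_union_of_starConvex (β : closedSmoothForms I' N ℝ l) {A B : Set E} (hA : IsOpen A) (hB : IsOpen B)
    {a₀ b₀ : E} (hstA : StarConvex ℝ a₀ A) (hstB : StarConvex ℝ b₀ B) (hAB : Agree N β (A ∩ B) (hA.inter hB)) :
    Agree N β (A ∪ B) (hA.union hB) := by
  intro k n h a
  cases k with
  | zero => exact lhs_eq_rhs_of_degree_zero (hA.union hB) β h a
  | succ k =>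
    obtain ⟨n, rfl⟩ : ∃ n', n = n' + 1 := ⟨n - 1, by omega⟩
    have h' : k + l = n := by omega
    obtain ⟨y, rfl⟩ := localDeRhamComplex.mvδ_surjective_of_isZero hA hB k
      (localDeRhamComplex.isZero_homology_of_starConvex hA hstA k)
      (localDeRhamComplex.isZero_homology_of_starConvex hB hstB k) a
    rw [← lhs_δ hA hB β h' y, ← rhs_δ hA hB β h' y, hAB k n h' y]

/-! ### The coordinate open sets `Q m`, `A m`, `B m` -/

section Coord

variable {d : ℕ} (φ : E ≃L[ℝ] (Fin d → ℝ))

/-- `Q m = {x | ∃ j < m, φ x j ≠ 0}`: the complement of the coordinate subspace `x₀ = ⋯ = x_{m-1} = 0`.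
[folklore] -/
def coordQ (m : ℕ) : Set E := {x | ∃ j : Fin d, (j : ℕ) < m ∧ φ x j ≠ 0}

/-- `A m = Q m ∪ {φ x m > 0}` (`m < d`). [folklore] -/
def coordA (m : Fin d) : Set E := {x | (∃ j : Fin d, (j : ℕ) < m ∧ φ x j ≠ 0) ∨ 0 < φ x m}

/-- `B m = Q m ∪ {φ x m < 0}` (`m < d`). [folklore] -/
def coordB (m : Fin d) : Set E := {x | (∃ j : Fin d, (j : ℕ) < m ∧ φ x j ≠ 0) ∨ φ x m < 0}

omit [FiniteDimensional ℝ E] in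
/-- The coordinates are continuous. [folklore] -/
theorem continuous_coord (j : Fin d) : Continuous fun x : E ↦ φ x j :=
  (continuous_apply j).comp φ.continuous

omit [FiniteDimensional ℝ E] in
/-- `Q m` is open. [folklore] -/
theorem isOpen_coordQ (m : ℕ) : IsOpen (coordQ φ m) := by
  have h : coordQ φ m = ⋃ j : Fin d, {x | (j : ℕ) < m ∧ φ x j ≠ 0} := by
    ext x
    simp only [coordQ, mem_setOf_eq, mem_iUnion]
  rw [h]
  refine isOpen_iUnion fun j ↦ ?_
  by_cases hj : (j : ℕ) < m
  · simp only [hj, true_and]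
    exact isOpen_ne_fun (continuous_coord φ j) continuous_const
  · simp only [hj, false_and, setOf_false, isOpen_empty]

omit [FiniteDimensional ℝ E] in
/-- `A m` is open. [folklore] -/
theorem isOpen_coordA (m : Fin d) : IsOpen (coordA φ m) := by
  have h : coordA φ m = coordQ φ m ∪ {x | 0 < φ x m} := rfl
  rw [h]
  exact (isOpen_coordQ φ m).union (isOpen_lt continuous_const (continuous_coord φ m))

omit [FiniteDimensional ℝ E] in
/-- `B m` is open. [folklore] -/
theorem isOpen_coordB (m : Fin d) : IsOpen (coordB φ m) := by
  have h : coordB φ m = coordQ φ m ∪ {x | φ x m < 0} := rfl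
  rw [h]
  exact (isOpen_coordQ φ m).union (isOpen_lt (continuous_coord φ m) continuous_const)

omit [FiniteDimensional ℝ E] in
/-- `Q 0 = ∅`. [folklore] -/
theorem coordQ_zero : coordQ φ 0 = ∅ := by
  ext x
  simp [coordQ]

omit [FiniteDimensional ℝ E] in
/-- `A m ∩ B m = Q m`. [folklore] -/
theorem coordA_inter_coordB (m : Fin d) : coordA φ m ∩ coordB φ m = coordQ φ m := by
  ext x
  simp only [coordA, coordB, coordQ, mem_inter_iff, mem_setOf_eq]
  constructor
  · rintro ⟨h₁ | h₁, h₂ | h₂⟩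
    · exact h₁
    · exact h₁
    · exact h₂
    · exact absurd (h₁.trans h₂) (lt_irrefl _)
  · intro h
    exact ⟨Or.inl h, Or.inl h⟩

omit [FiniteDimensional ℝ E] in
/-- `A m ∪ B m = Q (m + 1)`. [folklore] -/
theorem coordA_union_coordB (m : Fin d) : coordA φ m ∪ coordB φ m = coordQ φ (m + 1) := by
  ext x
  simp only [coordA, coordB, coordQ, mem_union, mem_setOf_eq]
  constructor
  · rintro ((⟨j, hj, hx⟩ | hx) | (⟨j, hj, hx⟩ | hx))
    · exact ⟨j, by omega, hx⟩
    · exact ⟨m, by omega, hx.ne'⟩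
    · exact ⟨j, by omega, hx⟩
    · exact ⟨m, by omega, hx.ne⟩
  · rintro ⟨j, hj, hx⟩
    rcases Nat.lt_or_ge (j : ℕ) m with hjm | hjm
    · exact Or.inl (Or.inl ⟨j, hjm, hx⟩)
    · have hjm' : j = m := Fin.ext (by omega)
      subst hjm'
      rcases lt_or_gt_of_ne hx with hlt | hgt
      · exact Or.inr (Or.inr hlt)
      · exact Or.inl (Or.inr hgt)

omit [FiniteDimensional ℝ E] in
/-- The star point `±φ⁻¹(eₘ)` and its coordinates. [folklore] -/
theorem coord_symm_single (m : Fin d) (c : ℝ) (j : Fin d) :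
    φ (φ.symm (Pi.single m c)) j = if j = m then c else 0 := by
  rw [ContinuousLinearEquiv.apply_symm_apply, Pi.single_apply]

omit [FiniteDimensional ℝ E] in
/-- **`A m` is star-shaped** about `φ⁻¹(eₘ)`. [folklore] -/
theorem starConvex_coordA (m : Fin d) : StarConvex ℝ (φ.symm (Pi.single m 1)) (coordA φ m) := by
  intro x hx s t hs ht hst
  have hcoord : ∀ j, φ (s • φ.symm (Pi.single m 1) + t • x) j = s * (if j = m then 1 else 0) + t * φ x j := by
    intro j
    rw [map_add, map_smul, map_smul, Pi.add_apply, Pi.smul_apply, Pi.smul_apply, coord_symm_single, smul_eq_mul,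
      smul_eq_mul]
  change (∃ j : Fin d, (j : ℕ) < m ∧ φ _ j ≠ 0) ∨ 0 < φ _ m
  rcases hx with ⟨j, hj, hxj⟩ | hxm
  · by_cases ht0 : t = 0
    · subst ht0
      rw [add_zero] at hst
      subst hst
      refine Or.inr ?_
      rw [hcoord, if_pos rfl]
      norm_num
    · refine Or.inl ⟨j, hj, ?_⟩
      rw [hcoord, if_neg (by intro h; subst h; exact lt_irrefl _ hj)]
      simpa using ⟨ht0, hxj⟩
  · refine Or.inr ?_
    rw [hcoord, if_pos rfl, mul_one]
    rcases eq_or_lt_of_le ht with rfl | ht'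
    · rw [add_zero] at hst
      subst hst
      norm_num
    · nlinarith

omit [FiniteDimensional ℝ E] in
/-- **`B m` is star-shaped** about `φ⁻¹(-eₘ)`. [folklore] -/
theorem starConvex_coordB (m : Fin d) : StarConvex ℝ (φ.symm (Pi.single m (-1))) (coordB φ m) := by
  intro x hx s t hs ht hst
  have hcoord : ∀ j, φ (s • φ.symm (Pi.single m (-1)) + t • x) j = s * (if j = m then -1 else 0) + t * φ x j := by
    intro j
    rw [map_add, map_smul, map_smul, Pi.add_apply, Pi.smul_apply, Pi.smul_apply, coord_symm_single, smul_eq_mul,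
      smul_eq_mul]
  change (∃ j : Fin d, (j : ℕ) < m ∧ φ _ j ≠ 0) ∨ φ _ m < 0
  rcases hx with ⟨j, hj, hxj⟩ | hxm
  · by_cases ht0 : t = 0
    · subst ht0
      rw [add_zero] at hst
      subst hst
      refine Or.inr ?_
      rw [hcoord, if_pos rfl]
      norm_num
    · refine Or.inl ⟨j, hj, ?_⟩
      rw [hcoord, if_neg (by intro h; subst h; exact lt_irrefl _ hj)]
      simpa using ⟨ht0, hxj⟩
  · refine Or.inr ?_
    rw [hcoord, if_pos rfl]
    rcases eq_or_lt_of_le ht with rfl | ht'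
    · rw [add_zero] at hst
      subst hst
      norm_num
    · nlinarith

/-- **The two sides agree on every coordinate open set `Q m` of the model space** (induction on `m`:
`Q 0 = ∅`; `Q (m+1) = A m ∪ B m` with `A m`, `B m` star-shaped and `A m ∩ B m = Q m`).
[cite: Bredon1993, Thm. V.9.5] -/
theorem agree_coordQ (β : closedSmoothForms I' N ℝ l) (m : ℕ) (hm : m ≤ d) : Agree N β (coordQ φ m) (isOpen_coordQ φ m) := by
  induction m with
  | zero => exact agree_congr_set β (coordQ_zero φ).symm _ _ (agree_empty β)
  | succ m ih =>
    have hm' : m < d := by omega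
    have ih' := ih hm'.le
    set μ : Fin d := ⟨m, hm'⟩
    have e₁ : coordA φ μ ∩ coordB φ μ = coordQ φ m := coordA_inter_coordB φ μ
    have e₂ : coordA φ μ ∪ coordB φ μ = coordQ φ (m + 1) := coordA_union_coordB φ μ
    exact agree_congr_set β e₂ _ _ (agree_union_of_starConvex β (isOpen_coordA φ μ) (isOpen_coordB φ μ)
      (starConvex_coordA φ μ) (starConvex_coordB φ μ) (agree_congr_set β e₁.symm _ _ ih'))

/-- **Multiplicativity on coordinate open sets**, unfolded: for every `m ≤ d`, every degree and every
class `a ∈ Hᵏ(Ω•(Q m))`, `lhs (Q m) a = rhs (Q m) a`. [cite: Bredon1993, Thm. V.9.5] -/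
theorem lhs_eq_rhs_coordQ (β : closedSmoothForms I' N ℝ l) {m : ℕ} (hm : m ≤ d) {k n : ℕ} (h : k + l = n)
    (a : (localDeRhamComplex 𝓘(ℝ, E) ℝ (isOpen_coordQ φ m)).homology k) :
    lhs N (isOpen_coordQ φ m) β k n h a = rhs N (isOpen_coordQ φ m) β k n h a :=
  agree_coordQ φ β m hm k n h a

end Coord

end Literature.Geometry.Manifold
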